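import Summits.Parity.BatemanHorn.Theses.AlmostPrimeZeros
import Summits.Parity.BatemanHorn.Theorems.SystemLSDRealSegment.Negative.Engines
import Summits.Parity.BatemanHorn.Theorems.SystemLSDRealSegment.Negative.Structure
import Summits.Parity.BatemanHorn.Theorems.SystemLSDRealSegment.Negative.FinZero
import Literature.NumberTheory.LFunctions.MertensConstant
import Literature.NumberTheory.Sieve.BatemanHornProofs

/-!
# Line `ewens-pd-kernel` — checked skeleton for crux `SystemLSDRealSegment`
(item stmt-Parity-11292, route `AlmostPrimeZeros`, sub-problem `BatemanHorn`)

Crux (by name, concluded by `SystemLSDRealSegment_of` below, fed by `systemLSDRealSegment_of_parts`):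
`Summit.Parity.BatemanHorn.Theses.AlmostPrimeZeros.SystemLSDRealSegment` — for every Bateman–Horn system
`f = (f₁,…,f_k)` there is `Λ` holomorphic on `|z| < 2` with `Λ 0 = C(f)` such that for every real
`y ∈ (5/4, 7/4)`, `x⁻¹ (log x)^{k(1−y)} Σ_{n ≤ x} y^{s_f(n)} → Λ(y) D^{y−1} Γ(y)^{−k}`, `D = ∏ deg fᵢ`,
`s_f(n) = Σᵢ Σ_{p^v ∥ fᵢ(n)} min(v,2)`.

## The line (idea card `Ideas/ewens-pd-kernel.md`; triage TRIAGE-r1-{1,2,3}.md: pass ×3, with sharpenings)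

EWENS / POISSON–DIRICHLET KERNEL.  `Λ` is PRODUCED, not postulated: `Λ = λ_f = eulerFactor f`, the ordered
Euler product `∏_p E_p(z)(1 − 1/p)^{k(z−1)}` of the local tilted means `E_p(z) = p⁻² Σ_{n mod p²} z^{Σᵢ cᵢ,ₚ(n)}`
(`cᵢ,ₚ(n) ∈ {0,1,2}` the capped `p`-adic valuation pattern of `fᵢ(n)`).  The weight `y^{s_f(n)}` is split at
`x^θ`: the small primes are expanded EXACTLY over `x^θ`-smooth divisor tuples `d` (`y^{s⁻(n)} = Σ_{d ∣ f(n)} h_y(d)`,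
`h_y ≥ 0` cube-free supported — the cap), whose sum over `∏ dᵢ ≤ x^η` is a finite Euler product `x ∏_{p ≤ x^θ} E_p(y)`
up to a Rankin tail in `η/θ` (LEVEL-FREE: complete periods, no equidistribution input); the large primes enter only
through the LAW of the windowed capped count `N_w(n) = #{(i, p) : x^θ < p ≤ x^{dᵢ−κ}, p ∣ fᵢ(n)}` (capped
multiplicity) inside each divisor class — and the single open statement `KPD` says this law is the law of the same
count for `k` INDEPENDENT UNIFORM INTEGERS `mᵢ ≤ x^{dᵢ}/dᵢ` (cofactor scale, triage r1-2 (i)), a `y`-FREE statement.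
The `y`-dependence of the crux's limit is then pure calibration ON ℕ: the windowed tilted mean of a uniform integer
tends to `C(a,b,t)` and `a^{t−1} C(a,b,t) → e^{−γ(t−1)}/Γ(t)` at the corner `(a,b) → (0,1)` — the Ewens sampling
normalisation of PD(1) — while Mertens turns `∏_{p ≤ x^θ} E_p(t)` into `λ_f(t)(e^γ θ log x)^{k(t−1)}`; the factors
`e^{±γ}` and `θ` cancel identically and `D^{t−1} = ∏ dᵢ^{t−1}` is the change of scale `log X_i = dᵢ log x`
(re-derived by all three triagers).  The top class (a prime `> x^{dᵢ−κ}`, i.e. `fᵢ(n)/m` prime with `m ≤ x^κ`: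
literally "BH on average over small multipliers") is REMOVED from `KPD` by the window and paid for by an upper-bound
sieve (`TiltedTails`, second clause; triage r1-1 (i)).

* `stub_eulerFactor` — analytic Euler bookkeeping (provable now, M): `eulerPartial f Y → λ_f` locally uniformly on
  `ℂ`, `λ_f` entire, `λ_f(0) = batemanHornConst f` (the partial product AT `z = 0` IS `batemanHornPartial f Y`),
  `λ_f(1) = 1`, `λ_f(t) > 0` real for real `t > 0`.  Input: `AZFG2020_tendsto_sum_sub_omega_div_holds` (PROVED).
* `stub_smallPrimes` — arithmetic Euler bookkeeping (provable now, M): the `x^θ`-smooth divisor-tuple expansion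
  truncated at `∏ dᵢ ≤ x^η` has main term `x ∏_{p ≤ x^θ} E_p(t)` with relative error `ε` once `η ≥ R(ε) θ`
  (CRT for the class densities; complete periods; Rankin with `σ = 1/(θ log x)`).
* `stub_integerEwens` — calibration on ℕ (provable now, M–L): Billingsley's law of the large prime factors of a
  uniform integer in windowed, tilted form, uniform over windows, with the Ewens constant `e^{−γ(t−1)}/Γ(t)` at
  the corner.  Inputs: Mertens (PROVED, `Literature.NumberTheory.LFunctions.Mertens.*`), Selberg–Delange on ℕ
  (`MontgomeryVaughan2007_thm_7_18_holds`, PROVED) or the explicit simplex integrals (docstring).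
* `stub_tiltedTails` — two tilted upper bounds along polynomial values (L; needs a VENDORED Nair–Tenenbaum 1998
  Thm 1 / Henriot 2012 Thm 3, not in the tree): the `x^θ`-smooth parts exceeding `x^η` carry `≤ ε` of the tilted
  mass once `η ≥ Rθ` (Rankin / canonical smooth divisor + NT in progressions), and the top class carries `≤ K κ`
  (upper-bound sieve for `fᵢ(n)/m` prime, `m ≤ x^κ`, spectator coordinates tilted: NT with one coordinate sifted).
* `stub_kpd` — THE KERNEL (open; the only stub beyond present technique): in every `x^θ`-smooth divisor class
  `A_d(x)`, `∏ dᵢ ≤ x^η`, `η ≤ η₀(f)`, the law of `N_w` equals the law of the model count up to `ε·#A_d(x)`.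
* `stub_splice` — the Ewens bookkeeping itself (provable now given the five inputs, M): exact expansion,
  monotone sandwich `S_adm ≤ S ≤ S_adm + Tail + Top`, law → generating function (finite), model product identity,
  `x → ∞` then `κ → 0` with `η = κ`, `θ = κ/R`, Mertens; output: the segment law AT `Λ = λ_f`.

Scope / honesty (triage r1-2 (iii), r1-3): for `Σ deg fᵢ ≤ 2` the moments behind `stub_kpd` are sub-critical
root counts (DFI/Tóth territory for `X²+1`: `dukeFriedlanderIwaniecToth_quadraticRoots_primeModuli`); for
`deg fᵢ ≥ 3` or `k ≥ 2` they are super-critical (BH-on-average hard), and for `deg fᵢ ≥ 4` the law statement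
also contains the sparsity of square divisors `p² ∣ fᵢ(n)`, `x < p < x^{dᵢ/2}` (Granville 1998: under ABC; known
for `deg ≤ 3`: Erdős 1953, Hooley 1967) — inherent in the crux's pin `Λ(0) = C(f)`, not added by the line.

Disproof used (`Cruxes/SystemLSDRealSegment/Disproof.lean` gen 2; landed copies imported from
`Theorems/SystemLSDRealSegment/Negative/`): `false_without_pairwise_not_associated` is honoured at `stub_kpd`
(the model has INDEPENDENT integers per coordinate — false for `(X, X)`, whose two coordinates share every large
prime) and at `stub_eulerFactor` (`Σ_p (ω_f(p) − k)/p` must converge: for `(X, X)`, `ω ≡ 1`, `k = 2`, the product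
diverges); `false_without_irreducible` at `stub_eulerFactor`/`stub_smallPrimes` (`X²`: capped pattern `c = 2`
w.p. `1/p`, `E_p(t) = 1 + (t² − 1)/p + …` against `(1 − 1/p)^{t−1}` — divergent) and at `stub_kpd` (large primes of
`n²` come squared: law ≠ model); `false_without_leadingCoeff_pos` at `stub_splice`/`divClass` (the expansion
`t^{s⁻(m)} = Σ_{d ∣ m} h_t(d)` is used only for POSITIVE values `m = fᵢ(n)`, `n ≥ n₀(f)`; for `−X` every value is
`toNat`-zero and `S(x) = x + 1`); `conclusion_fin_zero` (k = 0: `λ_∅ ≡ 1`, all stubs degenerate consistently, and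
`Negative.FinZero` is imported as the calibration); `not_omegaLawWide` (the cap: `h_t(p^v) = 0` for `v ≥ 3`,
`windowCount` capped at 2); `Λ_unique`/`eqOn_ball_of_eqOn_segment` (satisfied by construction: `Λ = λ_f` entire);
`Hr_one_tendsto` (`t = 1`: `h_1 = δ₁`, `E_p(1) = 1`, `λ_f(1) = 1` is a clause of `stub_eulerFactor`).  No stub is an
instance of a landed Negative lemma (`LoadBearing`, `OmegaWide` refute hypothesis-dropped / un-capped variants only).

`lean check`: rc 0, `sorry` exactly in the six `stub_*`; `systemLSDRealSegment_of_parts` (hypothesis form, crux body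
verbatim) is a real proof; `SystemLSDRealSegment_of : SystemLSDRealSegment` is the by-name skeleton theorem.
-/

namespace Summit.Parity.BatemanHorn.Cruxes.SystemLSDRealSegment.EwensPdKernel

open Polynomial Filter Finset
open Literature.NumberTheory.Sieve
open Summit.Parity.BatemanHorn.Theses.AlmostPrimeZeros (SystemLSDRealSegment)
open scoped BigOperators Topology Classical

noncomputable section

/-! ### Objects of the line -/

/-- The capped statistic of one value, `s(m) = Σ_{p^v ∥ m} min(v, 2)` (verbatim the crux's inner term). -/
def cappedOmega (m : ℕ) : ℕ :=
  m.factorization.sum fun _ v => min v 2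

/-- Windowed capped count: `Σ_{z < p ≤ w, p^v ∥ m} min(v, 2)` — the number of prime factors of `m` in the
window `(z, w]`, a prime whose square divides counted twice (the cap). -/
def windowCount (z w : ℝ) (m : ℕ) : ℕ :=
  m.factorization.sum fun p v => if z < (p : ℝ) ∧ (p : ℝ) ≤ w then min v 2 else 0

/-- The `z`-smooth part of `m`: `∏_{p ≤ z} p^{v_p(m)}` (`= 1` for `m = 0`). -/
def smoothPart (z : ℝ) (m : ℕ) : ℕ :=
  m.factorization.prod fun p v => if (p : ℝ) ≤ z then p ^ v else 1

/-- The thin weight `h_t = μ * (t^{s(·)})`: multiplicative, `h_t(p) = t − 1`, `h_t(p²) = t² − t`, `h_t(p^v) = 0`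
for `v ≥ 3`; `h_t ≥ 0` for `t ≥ 1` and `t^{s(m)} = Σ_{d ∣ m} h_t(d)` for `m ≥ 1`. -/
def thinWeight (t : ℝ) (m : ℕ) : ℝ :=
  m.factorization.prod fun _ v => if v = 1 then t - 1 else if v = 2 then t ^ 2 - t else 0

/-- Capped `p`-adic valuation pattern of `g(n)` read through congruences (periodic in `n` mod `p²`):
`2` if `p² ∣ g(n)`, `1` if `p ∥ g(n)`, `0` if `p ∤ g(n)`. -/
def cappedVal (p : ℕ) (g : ℤ[X]) (n : ℕ) : ℕ :=
  if (p : ℤ) ^ 2 ∣ g.eval (n : ℤ) then 2 else if (p : ℤ) ∣ g.eval (n : ℤ) then 1 else 0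

/-- The local tilted mean `E_p(z) = p⁻² Σ_{n mod p²} z^{Σᵢ cᵢ,ₚ(n)}` — a polynomial in `z` of degree `≤ 2k`,
`E_p(1) = 1`, `E_p(0) = 1 − ω_f(p)/p`. -/
def localFactor {k : ℕ} (f : Fin k → ℤ[X]) (p : ℕ) (z : ℂ) : ℂ :=
  ((p : ℂ) ^ 2)⁻¹ * ∑ n ∈ range (p ^ 2), z ^ (∑ i, cappedVal p (f i) n)

/-- The same local mean at a real argument, as a real number. -/
def localFactorR {k : ℕ} (f : Fin k → ℤ[X]) (p : ℕ) (t : ℝ) : ℝ :=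
  ((p : ℝ) ^ 2)⁻¹ * ∑ n ∈ range (p ^ 2), t ^ (∑ i, cappedVal p (f i) n)

/-- Ordered partial Euler product `λ_{f,Y}(z) = ∏_{p ≤ Y} E_p(z) (1 − 1/p)^{k(z−1)}` (principal complex power of
the positive real base `1 − 1/p`). At `z = 0` this is `batemanHornPartial f Y` (coerced). -/
def eulerPartial {k : ℕ} (f : Fin k → ℤ[X]) (Y : ℕ) (z : ℂ) : ℂ :=
  ∏ p ∈ Nat.primesLE Y, localFactor f p z * (1 - (p : ℂ)⁻¹) ^ ((k : ℂ) * (z - 1))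

/-- `λ_f(z) := lim_{Y → ∞} λ_{f,Y}(z)` — the line's explicit `Λ` (ordered limit; junk where divergent, which
`EulerFactorLaw` excludes for Bateman–Horn systems). -/
def eulerFactor {k : ℕ} (f : Fin k → ℤ[X]) (z : ℂ) : ℂ :=
  limUnder atTop fun Y : ℕ => eulerPartial f Y z

/-- The `i`-th value as a natural number (the crux's `toNat` convention). -/
def val {k : ℕ} (f : Fin k → ℤ[X]) (i : Fin k) (n : ℕ) : ℕ :=
  ((f i).eval (n : ℤ)).toNat

/-- The system statistic `s_f(n) = Σᵢ s(fᵢ(n))` (equal to the crux's exponent). -/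
def sysStat {k : ℕ} (f : Fin k → ℤ[X]) (n : ℕ) : ℕ :=
  ∑ i, cappedOmega (val f i n)

/-- Admissible divisor tuples at `(θ, η, x)`: `d : Fin k → ℕ` with `1 ≤ dᵢ`, `∏ dᵢ ≤ x^η` and every prime factor
of every `dᵢ` at most `x^θ` (the `x^θ`-smooth tuples of the small-prime expansion, truncated at `x^η`). -/
def admissible (k : ℕ) (θ η : ℝ) (x : ℕ) : Finset (Fin k → ℕ) :=
  (Fintype.piFinset fun _ : Fin k => Icc 1 x).filter fun d =>
    (∏ i, (d i : ℝ)) ≤ (x : ℝ) ^ η ∧ ∀ i, ∀ p ∈ (d i).primeFactors, (p : ℝ) ≤ (x : ℝ) ^ θ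

/-- The divisor class `A_d(x) = {0 ≤ n ≤ x : fᵢ(n) > 0 and dᵢ ∣ fᵢ(n) for every i}` (positivity of the values is
where `leadingCoeff_pos` enters: it discards only `n < n₀(f)`). -/
def divClass {k : ℕ} (f : Fin k → ℤ[X]) (d : Fin k → ℕ) (x : ℕ) : Finset ℕ :=
  (range (x + 1)).filter fun n : ℕ => ∀ i, 0 < (f i).eval (n : ℤ) ∧ ((d i : ℕ) : ℤ) ∣ (f i).eval (n : ℤ)

/-- The windowed large-prime count of the system: `N_w(n) = Σᵢ #{x^θ < p ≤ x^{deg fᵢ − κ} : p ∣ fᵢ(n)}` (capped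
multiplicity). Bounded: `N_w(n) ≤ Σᵢ 2(deg fᵢ + 1)/θ` for `x` large. The TOP class `p > x^{deg fᵢ − κ}` is cut out. -/
def sysWindowCount {k : ℕ} (f : Fin k → ℤ[X]) (θ κ : ℝ) (x n : ℕ) : ℕ :=
  ∑ i, windowCount ((x : ℝ) ^ θ) ((x : ℝ) ^ (((f i).natDegree : ℝ) - κ)) (val f i n)

/-- INTEGER MODEL, tilted form: `X⁻¹ Σ_{1 ≤ m ≤ X} t^{windowCount z w m}` — the windowed tilted mean of a uniform
random integer `m ≤ X`. -/
def modelMean (X : ℕ) (z w t : ℝ) : ℝ :=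
  (X : ℝ)⁻¹ * ∑ m ∈ Icc 1 X, t ^ windowCount z w m

/-- INTEGER MODEL, law form: the probability that `k` INDEPENDENT uniform integers `mᵢ ≤ Xᵢ` have total windowed
count `Σᵢ windowCount z wᵢ mᵢ = j`. (Its generating function in `j` is `∏ᵢ modelMean (X i) z (w i) t`.) -/
def modelLaw {k : ℕ} (X : Fin k → ℕ) (z : ℝ) (w : Fin k → ℝ) (j : ℕ) : ℝ :=
  (∏ i, (X i : ℝ))⁻¹ *
    (#((Fintype.piFinset fun i => Icc 1 (X i)).filter fun m => ∑ i, windowCount z (w i) (m i) = j) : ℝ)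

/-! ### The six stub statements (named, so that the composition is literal) -/

/-- `EulerFactorLaw k f`: the ordered Euler product `λ_{f,Y}` converges locally uniformly on `ℂ` to the entire
function `λ_f = eulerFactor f`, with `λ_f(0) = batemanHornConst f`, `λ_f(1) = 1`, and `λ_f(t)` real `> 0` for
real `t > 0`. -/
def EulerFactorLaw (k : ℕ) (f : Fin k → ℤ[X]) : Prop :=
  TendstoLocallyUniformly (fun Y : ℕ => eulerPartial f Y) (eulerFactor f) atTop ∧
    Differentiable ℂ (eulerFactor f) ∧
    eulerFactor f 0 = (batemanHornConst f : ℂ) ∧ eulerFactor f 1 = 1 ∧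
    ∀ t : ℝ, 0 < t → ∃ r : ℝ, 0 < r ∧ eulerFactor f (t : ℂ) = (r : ℂ)

/-- `SmallPrimeSum k f`: for `t ∈ [1, 2]` and `ε > 0` there is `R` such that whenever `0 < θ`, `Rθ ≤ η ≤ 1/2`,
eventually in `x`: `|Σ_{d admissible} h_t(d) #A_d(x) − x ∏_{p ≤ x^θ} E_p(t)| ≤ ε x ∏_{p ≤ x^θ} E_p(t)`
(`h_t(d) = ∏ᵢ h_t(dᵢ)`). -/
def SmallPrimeSum (k : ℕ) (f : Fin k → ℤ[X]) : Prop :=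
  ∀ t : ℝ, 1 ≤ t → t ≤ 2 → ∀ ε : ℝ, 0 < ε → ∃ R : ℝ, 0 < R ∧
    ∀ θ η : ℝ, 0 < θ → R * θ ≤ η → η ≤ 1 / 2 →
      ∀ᶠ x : ℕ in atTop,
        |(∑ d ∈ admissible k θ η x, (∏ i, thinWeight t (d i)) * (#(divClass f d x) : ℝ)) -
            (x : ℝ) * ∏ p ∈ Nat.primesLE ⌊(x : ℝ) ^ θ⌋₊, localFactorR f p t| ≤
          ε * ((x : ℝ) * ∏ p ∈ Nat.primesLE ⌊(x : ℝ) ^ θ⌋₊, localFactorR f p t)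

/-- `IntegerEwens`: there is a limit functional `C(a, b, t)` such that for `t ∈ [1, 2]`:
(i) `modelMean X X^a X^b t → C(a, b, t)` as `X → ∞`, uniformly over windows `a₀ ≤ a ≤ b ≤ 1`;
(ii) `a^{t−1} C(a, b, t) → e^{−γ(t−1)}/Γ(t)` as `(a, b) → (0, 1)` within `{0 < a ≤ b ≤ 1}` (the Ewens constant of
Poisson–Dirichlet PD(1); explicitly `C(a,b,t) = Σ_{j ≥ 0} (t−1)^j/j! ∫_{[a,b]^j, Σuᵢ ≤ 1} ∏ duᵢ/uᵢ`). -/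
def IntegerEwens : Prop :=
  ∃ C : ℝ → ℝ → ℝ → ℝ, ∀ t : ℝ, 1 ≤ t → t ≤ 2 →
    (∀ a₀ : ℝ, 0 < a₀ → ∀ ε : ℝ, 0 < ε → ∀ᶠ X : ℕ in atTop, ∀ a b : ℝ, a₀ ≤ a → a ≤ b → b ≤ 1 →
        |modelMean X ((X : ℝ) ^ a) ((X : ℝ) ^ b) t - C a b t| ≤ ε) ∧
    Tendsto (fun q : ℝ × ℝ => q.1 ^ (t - 1) * C q.1 q.2 t)
      (𝓝[{q : ℝ × ℝ | 0 < q.1 ∧ q.1 ≤ q.2 ∧ q.2 ≤ 1}] ((0 : ℝ), (1 : ℝ)))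
      (𝓝 (Real.exp (-(Real.eulerMascheroniConstant * (t - 1))) / Real.Gamma t))

/-- `TiltedTails k f`: two upper bounds for tilted masses of exceptional `n ≤ x` (all values positive), for
`t ∈ [1, 2]`: (a) smooth tail — for `ε > 0` there is `R` such that for `0 < θ`, `Rθ ≤ η ≤ 1/2`, eventually
`Σ_{n : ∏ᵢ smoothPart_{x^θ}(fᵢ(n)) > x^η} t^{s_f(n)} ≤ ε x (log x)^{k(t−1)}`; (b) top class — there is `K` such that
for `0 < κ ≤ 1/2`, eventually `Σ_{n : some fᵢ(n) has a prime factor > x^{deg fᵢ − κ}} t^{s_f(n)} ≤ K κ x (log x)^{k(t−1)}`. -/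
def TiltedTails (k : ℕ) (f : Fin k → ℤ[X]) : Prop :=
  (∀ t : ℝ, 1 ≤ t → t ≤ 2 → ∀ ε : ℝ, 0 < ε → ∃ R : ℝ, 0 < R ∧
      ∀ θ η : ℝ, 0 < θ → R * θ ≤ η → η ≤ 1 / 2 →
        ∀ᶠ x : ℕ in atTop,
          (∑ n ∈ (range (x + 1)).filter (fun n : ℕ => (∀ i, 0 < (f i).eval (n : ℤ)) ∧
              (x : ℝ) ^ η < ∏ i, (smoothPart ((x : ℝ) ^ θ) (val f i n) : ℝ)),
            t ^ sysStat f n) ≤ ε * ((x : ℝ) * Real.log x ^ ((k : ℝ) * (t - 1)))) ∧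
  (∀ t : ℝ, 1 ≤ t → t ≤ 2 → ∃ K : ℝ, ∀ κ : ℝ, 0 < κ → κ ≤ 1 / 2 →
      ∀ᶠ x : ℕ in atTop,
        (∑ n ∈ (range (x + 1)).filter (fun n : ℕ => (∀ i, 0 < (f i).eval (n : ℤ)) ∧
            ∃ i, ∃ p ∈ (val f i n).primeFactors, (x : ℝ) ^ (((f i).natDegree : ℝ) - κ) < (p : ℝ)),
          t ^ sysStat f n) ≤ K * κ * ((x : ℝ) * Real.log x ^ ((k : ℝ) * (t - 1))))

/-- `KPD k f` — the Poisson–Dirichlet kernel in comparison (integer-model) form, law level, `y`-free: for some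
`η₀ = η₀(f) > 0`, all `0 < θ < η ≤ η₀`, `0 < κ ≤ η₀` and `ε > 0`, eventually in `x`, for EVERY admissible tuple `d`
and every `j`: `|#{n ∈ A_d(x) : N_w(n) = j} − #A_d(x) · P(Σᵢ windowCount(mᵢ) = j)| ≤ ε #A_d(x)`, the model having
independent uniform `mᵢ ≤ ⌊x^{deg fᵢ}/dᵢ⌋` (COFACTOR scale) and the same absolute window `(x^θ, x^{deg fᵢ − κ}]`. -/
def KPD (k : ℕ) (f : Fin k → ℤ[X]) : Prop :=
  ∃ η₀ : ℝ, 0 < η₀ ∧ ∀ θ η κ : ℝ, 0 < θ → θ < η → η ≤ η₀ → 0 < κ → κ ≤ η₀ →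
    ∀ ε : ℝ, 0 < ε → ∀ᶠ x : ℕ in atTop, ∀ d ∈ admissible k θ η x, ∀ j : ℕ,
      |(#((divClass f d x).filter fun n : ℕ => sysWindowCount f θ κ x n = j) : ℝ) -
          (#(divClass f d x) : ℝ) *
            modelLaw (fun i => ⌊(x : ℝ) ^ ((f i).natDegree : ℝ) / (d i : ℝ)⌋₊) ((x : ℝ) ^ θ)
              (fun i => (x : ℝ) ^ (((f i).natDegree : ℝ) - κ)) j| ≤
        ε * (#(divClass f d x) : ℝ)

/-- `SegmentLawAt k f Λ y`: the crux's real-segment convergence for ONE `(k, f)`, ONE `y` and a GIVEN `Λ`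
(the crux's `Tendsto` clause verbatim). -/
def SegmentLawAt (k : ℕ) (f : Fin k → ℤ[X]) (Λ : ℂ → ℂ) (y : ℝ) : Prop :=
  Filter.Tendsto (fun x : ℕ => (x : ℂ)⁻¹ * Complex.exp ((k : ℂ) * (1 - (y : ℂ)) * (Real.log (Real.log x) : ℂ)) *
    ∑ n ∈ Finset.range (x + 1), (y : ℂ) ^ (∑ i, (((f i).eval (n : ℤ)).toNat.factorization.sum fun _ v => min v 2)))
    Filter.atTop (nhds (Λ y * Complex.exp (((y : ℂ) - 1) * (Real.log (∏ i, ((f i).natDegree : ℝ)) : ℂ)) *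
      (Complex.Gamma y)⁻¹ ^ k))

/-! ### The registered stubs -/

/-- **stub_eulerFactor** (provable now; size M).  For a Bateman–Horn system: (1) for `p ∤ R_f` (finitely many
resultant/discriminant primes excepted) the patterns with `Σᵢ cᵢ ≥ 2` have density `O_f(p⁻²)` among `n mod p²`
(two coordinates share no root mod `p`; a simple root lifts to one root mod `p²`), and `#{n mod p² : p ∣ F(n)} =
p·ω_f(p)`, so `E_p(z) = 1 + (z − 1) ω_f(p)/p + O_R(p⁻²)` on `|z| ≤ R`; (2) hence
`log[E_p(z)(1 − 1/p)^{k(z−1)}] = (z − 1)(ω_f(p) − k)/p + O_R(p⁻²)`, and the ORDERED sum `Σ_p (ω_f(p) − k)/p`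
converges — `Literature.NumberTheory.Sieve.AZFG2020_tendsto_sum_sub_omega_div_holds` (PROVED) — so `λ_{f,Y}`
converges locally uniformly (Cauchy in `Y`, `exp` of a locally uniformly convergent series); the limit is entire
(`TendstoLocallyUniformlyOn.differentiableOn`, each `λ_{f,Y}` entire: finite product of polynomials and
`w ↦ c^w`, `c > 0`); (3) `z = 0`: `0^{Σc} = [Σc = 0]`, `E_p(0) = 1 − ω_f(p)/p`, `(1 − 1/p)^{−k}`: the partial
product is `batemanHornPartial f Y` coerced, and `IsBatemanHornSystem.hasBatemanHornConst_holds` (PROVED)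
identifies the limit; (4) `z = 1`: every factor is `1`; (5) real `t > 0`: every factor is a positive real and
the log-series converges, so the limit is `exp` of a real number.  Where `irreducible` (mean of `ρ_{fᵢ}` is 1,
prime ideal theorem inside AZFG2020) and `pairwise_not_associated` (`ω_f = Σ ρᵢ` off the resultant primes) enter
— cf. `Negative.LoadBearing`. -/
theorem stub_eulerFactor :
    ∀ (k : ℕ) (f : Fin k → ℤ[X]), IsBatemanHornSystem f → EulerFactorLaw k f := by
  sorry

/-- **stub_smallPrimes** (provable now; size M; LEVEL-FREE).  `#A_d(x) = x·g_f(d) + O(ν_f(d)) + O(n₀)` where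
`g_f(d)` is the density of `{n : dᵢ ∣ fᵢ(n) ∀ i}` (a union of `ν_f(d) = g_f(d)·lcm(d) ≤ g_f(d) x^η` classes modulo
`lcm(dᵢ) ≤ ∏ dᵢ ≤ x^η ≤ √x`: complete periods, NO equidistribution input) and `n₀ = n₀(f)` discards the non-positive
values; `g_f` is multiplicative over the prime-power parts of the tuple (CRT) with
`Σ_{e ∈ {0,1,2}^k} ∏ᵢ h_t(p^{eᵢ}) g_f(p^e) = E_n[∏ᵢ Σ_{eᵢ ≤ cᵢ(n)} h_t(p^{eᵢ})] = E_n[t^{Σᵢ cᵢ(n)}] = E_p(t)`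
(`1 + (t−1) = t`, `1 + (t−1) + (t²−t) = t²`; `h_t(p^v) = 0` for `v ≥ 3` — the cap), so the FULL smooth sum is
`Σ_{d smooth} h_t(d) g_f(d) = ∏_{p ≤ x^θ} E_p(t)` exactly; the part `∏ dᵢ > x^η` is `≤ x^{−ησ} Σ_d h_t g_f (∏dᵢ)^σ
= e^{−η/θ} ∏_p E_p^{(σ)}(t) ≤ e^{−η/θ + O_{f,t}(1)} ∏_p E_p(t)` with `σ = 1/(θ log x)` (Rankin;
`Σ_{p ≤ x^θ} (p^σ − 1)/p ≤ ∫₀¹ (e^v − 1) dv/v`); the error terms are `≤ x^{η + o(1)} ∏ E_p = o(x ∏ E_p)` since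
`h_t(dᵢ) ≤ 2^{ω(dᵢ)}` for `t ≤ 2` and `#admissible ≤ x^η (log x)^k`.  Take `R = log(1/ε) + O_{f,t}(1)`.
(Beta-thinned-root-kernel's `TypeIPart`, triage r1-2/r1-3, needs a Wirsing mean-value lemma because it sums ALL
`d ≤ x`; summing SMOOTH `d` only makes the main term a finite Euler product.) -/
theorem stub_smallPrimes :
    ∀ (k : ℕ) (f : Fin k → ℤ[X]), IsBatemanHornSystem f → SmallPrimeSum k f := by
  sorry

/-- **stub_integerEwens** (provable now; size M–L; pure integers + real analysis — the `f = X` calibration of the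
card, Disproof §6 `LinearInstance`).  (i) For distinct primes `p₁ < … < p_j` in `(X^a, X^b]` the density of
`{m ≤ X : p₁⋯p_j ∣ m}` is `1/(p₁⋯p_j)` if `p₁⋯p_j ≤ X` (else `≤ 1/X`-junk), so by Mertens
(`Literature.NumberTheory.LFunctions.Mertens.tendsto_primeRecipSum_sub_loglog`, PROVED) the factorial moments of the
windowed count converge to `J_j(a,b) = ∫_{[a,b]^j ∩ {Σu ≤ 1}} ∏ duᵢ/uᵢ` (finitely many `j ≤ 1/a`; squares `p² ∣ m`,
`p > X^a`, have density `≤ Σ_{p > X^a} p⁻² → 0`), whence `modelMean → C(a,b,t) := Σ_j (t−1)^j J_j(a,b)/j!`;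
uniformity over `a₀ ≤ a ≤ b ≤ 1` from monotonicity of the count in the window plus continuity of `C` (Dini/Pólya).
(ii) `C(a,1,t)` is `E[t^{K_a}]` for the number `K_a` of PD(1) components exceeding `a` (Billingsley 1972); the
Ewens sampling formula / Selberg–Delange on ℕ give `a^{t−1} C(a,1,t) → e^{−γ(t−1)}/Γ(t)`: indeed
`X⁻¹ Σ_{m ≤ X} t^{ω(m)} ~ F(t)(log X)^{t−1}/Γ(t)` with `F(t) = ∏_p (1 + (t−1)/p)(1 − 1/p)^{t−1}`
(`MontgomeryVaughan2007_thm_7_18_holds`, PROVED, TW-class) while the primes `≤ X^a` alone contribute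
`F(t)(e^γ a log X)^{t−1}(1 + o_{a→0}(1))` (Mertens' third theorem `…Mertens.tendsto_log_mul_prod_one_sub_inv`,
PROVED, + Kubilius-type asymptotic independence of the small primes from the window as `a → 0`); the top sliver
`(b, 1]` costs `O((1 − b) a^{1−t})` (one prime `> X^b`, `m = p·r`, `r ≤ X^{1−b}`).  Checks: `t = 1` both sides `1`;
`t = 2`: `Σ_{d ≤ X, P⁻(d) > X^a} μ²(d)/d ~ e^{−γ}/a` (de Bruijn–Buchstab `ω(u) → e^{−γ}`) = `e^{−γ}/Γ(2)·a^{−1}` ✓. -/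
theorem stub_integerEwens : IntegerEwens := by
  sorry

/-- **stub_tiltedTails** (size L; needs a VENDORED fact: Nair–Tenenbaum 1998 Thm 1 (doi:10.1007/BF02392880) /
Henriot 2012 Thm 3 (doi:10.1017/S0305004111000752) — `Σ_{n ≤ x} G(|f₁(n)|,…,|f_k(n)|) ≪ x ∏_{p ≤ x}(1 − ω_f(p)/p)
Σ_{n₁⋯n_k ≤ x} G(n) g̃_f(n)/n`-type upper bounds for non-negative sub-multiplicative `G`, uniform in progressions
`n ≡ a (q)`, `q ≤ x^{1−ε}`; NOT in the tree (triage r1-1 (ii), r1-2)).  (a) Smooth tail: `∏ᵢ smᵢ(n) > x^η` forces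
some `smᵢ(n) > x^{η/k}`, hence a CANONICAL `x^θ`-smooth divisor `e ∥ fᵢ(n)` (the `P⁺(e)`-smooth part) with
`e ∈ (x^{η/k}, x^{η/k+θ}]`; NT in the classes `e ∣ fᵢ(n)` with the cofactor sifted below `P⁺(e)` gives
`≪ t^{s(e)} ρᵢ(e)/(e log P⁺(e)) · x (log x)^{k(t−1)}`-type terms whose sum over such `e` is `≪ exp(−c η/(kθ))`
relative (Rankin / de Bruijn: the `x^θ`-smooth part exceeds `x^η` with tilted probability decaying in `η/θ`);
`R = R(ε, f, t)`.  (b) Top class: a prime `p > x^{dᵢ−κ} (≥ x^{dᵢ/2})` dividing `fᵢ(n) ≤ A x^{dᵢ}` means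
`fᵢ(n) = m·p` with `m ≤ A x^κ`, at most one such `p`; for each `m`, the `n ≤ x` with `m ∣ fᵢ(n)` and `fᵢ(n)/m`
prime are `≪ ρᵢ(m) x/(φ-corrected m · log x)` by an upper-bound sieve (Selberg / `β`-sieve, dimension 1; the tree's
`SieveSequence.fundamental_lemma_uniform_holds` pattern), with the spectator tilt `∏_{j} t^{s(f_j(n))}` carried by NT
(one coordinate sifted): total `≪ t Σ_{m ≤ A x^κ} t^{s(m)} ρᵢ(m)/m · x (log x)^{(k−1)(t−1)+(t−1)} / log x ≪
κ^t x (log x)^{k(t−1)} ≤ κ·K x (log x)^{k(t−1)}` (`t ≥ 1`, `κ ≤ 1/2`; triage r1-1: "O(η'^y) tilted mass").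
Positivity of the weights (`t ≥ 1`) is essential (triage r1-2 (ii)); no lower bound, no parity. -/
theorem stub_tiltedTails :
    ∀ (k : ℕ) (f : Fin k → ℤ[X]), IsBatemanHornSystem f → TiltedTails k f := by
  sorry

/-- **stub_kpd** — THE KERNEL (OPEN; the line's single load-bearing arithmetic input; `y`-free).  Heuristic =
Disproof §6 item 1 made into a statement: conditionally on `dᵢ ∣ fᵢ(n)` the large prime factors of the cofactors
`fᵢ(n)/dᵢ ≍ x^{dᵢ}/dᵢ` are distributed like those of INDEPENDENT uniform integers of that size (Poisson–Dirichlet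
PD(1) at scale `log(x^{dᵢ}/dᵢ)`, Billingsley), jointly over `i` (independence = `pairwise_not_associated`: coprime
values off the resultant primes; FALSE for `(X, X)` — `Negative.false_without_pairwise_not_associated`).  By the
method of moments the law of `N_w` in `A_d(x)` is determined by the counts of `n ∈ A_d(x)`, with
`p₁⋯p_r ∣ fᵢ(n)`-type conditions for primes in the window, i.e. ROOT COUNTS of `F = ∏ fᵢ` modulo `lcm(d)·p₁⋯p_r`
counted in `[0, x]`: sub-critical (modulus `≤ x^{1−δ}`: trivial level of distribution, complete periods) when
`Σ log pⱼ ≤ (1 − δ) log x`; the macroscopic slice (moduli `≤ C·x`) is what the tree facts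
`dukeFriedlanderIwaniecToth_quadraticRoots_primeModuli` / `hooley_polyRoots_equidistributed` certify (fixed frequency,
no rate — triage r1-1 leans-on audit; a power range `x^{1+δ}` needs Deshouillers–Iwaniec 1982 / de la Bretèche–Drappeau
arXiv:1703.03197, not vendored); super-critical beyond ("BH for `fᵢ(n)/m` on average over `m`", Merikoski
arXiv:1908.08816 §4: bounds, not asymptotics) — for `k = 1`, `deg f = 2` the open part is the one-point law beyond
`x^{1+o(1)}` (= `subcritical-root-equidistribution`'s `PrimeRootCountSubcritical`, the same object; triage merge
note), for `deg fᵢ ≥ 3` or `k ≥ 2` most of the mass is super-critical (triage r1-2 (iii)),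
and for `deg fᵢ ≥ 4` the statement also contains the sparsity of square divisors `p² ∣ fᵢ(n)`, `x < p < x^{dᵢ/2}`
(Erdős 1953 / Hooley 1967 for cubics; Granville 1998 under ABC in general).  Uniformity in `d` only up to
`x^{η₀(f)}`; the cofactor scale `⌊x^{dᵢ}/dᵢ⌋` answers triage r1-2 (i) (at `d ≈ x^η` the fixed scale `x^{dᵢ}` is off
by the factor `(1 − η/dᵢ)^{t−1}`).  Implied by uniform Bateman–Horn for the cofactor families (Martin 2002,
arXiv:math/9909180, Dartyge–Martin–Tenenbaum 2001); implies nothing signed.  First milestones: `k = 1`, `f = X`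
(TRUE: `A_d` = multiples, exact model up to the floor); `f = X² + 1`, `j`-law of the windowed count for `q = 1`
(cheapest falsifier: `#{n ≤ x : P⁺(n²+1) > x} / x → log 2`, measured `0.6696/0.6764/0.6792/0.6803` at
`10⁴…3·10⁶`, deficit `≍ 0.19/log x`, kit j006851). -/
theorem stub_kpd :
    ∀ (k : ℕ) (f : Fin k → ℤ[X]), IsBatemanHornSystem f → KPD k f := by
  sorry

/-- **stub_splice** — the Ewens bookkeeping (provable now GIVEN the five inputs; size M; real analysis and exact
identities, no arithmetic beyond Mertens).  For `k, f`, `y = t ∈ (5/4, 7/4)`: (0) drop the `n < n₀(f)` with a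
non-positive value (`leadingCoeff_pos`; `O(1)` terms against `x (log x)^{k(t−1)} → ∞`-normalisation… for `k = 0`
everything is constant and `λ_∅ ≡ 1`, cf. `Negative.FinZero`); (1) EXACT EXPANSION `t^{s_f(n)} = t^{s⁺(n)} Σ_{d ∣ f(n),
x^θ-smooth} h_t(d)` (`h_t ≥ 0` as `t ≥ 1`); (2) SANDWICH: with `S_adm := Σ_{d adm} h_t(d) Σ_{n ∈ A_d} t^{N_w(n)}` one has
`S_adm ≤ S(x) ≤ S_adm + Tail(θ,η) + Top(κ)` (outside the top class `s⁺ = N_w`; if `∏ smᵢ(n) ≤ x^η` every smooth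
tuple-divisor is admissible); (3) KPD (law) ⇒ `|Σ_{A_d} t^{N_w} − #A_d Σ_j t^j P_model(j)| ≤ ε (Σ_{j ≤ J} t^j) #A_d`
with `J = J(θ, f)` a uniform bound for `N_w` on both sides; `Σ_j t^j P_model(j) = ∏ᵢ modelMean Xᵢ x^θ x^{dᵢ−κ} t`
(sum over `Fintype.piFinset` of a product); (4) `IntegerEwens` (i) at `Xᵢ = ⌊x^{dᵢ}/dᵢ⌋ ≥ √x → ∞` with
`a = θ log x/log Xᵢ ∈ [θ/dᵢ, θ/(dᵢ−η) + o(1)]`, `b = (dᵢ−κ) log x/log Xᵢ ∈ [1 − κ/dᵢ, 1]` (needs `η ≤ κ`), then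
`SmallPrimeSum` for `Σ_d h_t(d) #A_d`; (5) LIMITS: `x → ∞` for fixed `(θ, η, κ)` gives
`limsup/liminf` of `H_x(t)` within `[(1−ε)³ m, (1+ε)³ M + ε + Kκ]·(θ log x)^{−k(t−1)}∏_{p ≤ x^θ}E_p(t)·(log x)^{…}`
where `m, M` are `inf/sup` of `∏ᵢ C(aᵢ, bᵢ, t)` over the parameter box; Mertens' third theorem
(`Literature.NumberTheory.LFunctions.Mertens.tendsto_log_mul_prod_one_sub_inv`, PROVED) and `EulerFactorLaw` give
`(θ log x)^{−k(t−1)} ∏_{p ≤ x^θ} E_p(t) → λ_f(t) e^{γk(t−1)}`; finally `κ → 0` with `η = κ`, `θ = κ/R`: by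
`IntegerEwens` (ii) `θ^{t−1} C(aᵢ,bᵢ,t) → dᵢ^{t−1} e^{−γ(t−1)}/Γ(t)` uniformly on the box, so the bracket tends to
`λ_f(t) e^{γk(t−1)} ∏ᵢ dᵢ^{t−1} e^{−γ(t−1)}/Γ(t) = λ_f(t) D^{t−1} Γ(t)^{−k}` (`e^{±γ}`, `θ` cancel identically —
triage r1-1/r1-3); (6) real → complex (`Negative.Engines.tendsto_ofReal_of_tendsto`, `λ_f(t)` real by
`EulerFactorLaw`, `Complex.Gamma_ofReal`). -/
theorem stub_splice :
    ∀ (k : ℕ) (f : Fin k → ℤ[X]), IsBatemanHornSystem f →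
      EulerFactorLaw k f → SmallPrimeSum k f → IntegerEwens → TiltedTails k f → KPD k f →
        ∀ y : ℝ, 5 / 4 < y → y < 7 / 4 → SegmentLawAt k f (eulerFactor f) y := by
  sorry

/-! ### The composition: the stubs imply the crux BY NAME -/

/-- **The crux's statement from the six stub STATEMENTS** (hypothesis form; real proof, no `sorry`, axioms ⊆
{propext, Classical.choice, Quot.sound}).  The conclusion is the crux's body verbatim (so that the by-name audit
sees exactly one theorem concluding `SystemLSDRealSegment`, the next one).  Proof: take `Λ := eulerFactor f`;
holomorphy on `ball 0 2` and `Λ 0 = C(f)` are clauses of `EulerFactorLaw`; the segment law is the splice. -/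
theorem systemLSDRealSegment_of_parts
    (hE : ∀ (k : ℕ) (f : Fin k → ℤ[X]), IsBatemanHornSystem f → EulerFactorLaw k f)
    (hS : ∀ (k : ℕ) (f : Fin k → ℤ[X]), IsBatemanHornSystem f → SmallPrimeSum k f)
    (hI : IntegerEwens)
    (hT : ∀ (k : ℕ) (f : Fin k → ℤ[X]), IsBatemanHornSystem f → TiltedTails k f)
    (hK : ∀ (k : ℕ) (f : Fin k → ℤ[X]), IsBatemanHornSystem f → KPD k f)
    (hSp : ∀ (k : ℕ) (f : Fin k → ℤ[X]), IsBatemanHornSystem f →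
      EulerFactorLaw k f → SmallPrimeSum k f → IntegerEwens → TiltedTails k f → KPD k f →
        ∀ y : ℝ, 5 / 4 < y → y < 7 / 4 → SegmentLawAt k f (eulerFactor f) y) :
    ∀ (k : ℕ) (f : Fin k → Polynomial ℤ), Literature.NumberTheory.Sieve.IsBatemanHornSystem f →
      ∃ Λ : ℂ → ℂ, DifferentiableOn ℂ Λ (Metric.ball 0 2) ∧
        Λ 0 = (Literature.NumberTheory.Sieve.batemanHornConst f : ℂ) ∧
        ∀ y : ℝ, 5 / 4 < y → y < 7 / 4 → Filter.Tendsto (fun x : ℕ => (x : ℂ)⁻¹ *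
          Complex.exp ((k : ℂ) * (1 - (y : ℂ)) * (Real.log (Real.log x) : ℂ)) *
          ∑ n ∈ Finset.range (x + 1), (y : ℂ) ^ (∑ i, (((f i).eval (n : ℤ)).toNat.factorization.sum
            fun _ v => min v 2))) Filter.atTop (nhds (Λ y * Complex.exp (((y : ℂ) - 1) *
          (Real.log (∏ i, ((f i).natDegree : ℝ)) : ℂ)) * (Complex.Gamma y)⁻¹ ^ k)) := by
  intro k f hf
  obtain ⟨_, hdiff, h0, _, _⟩ := hE k f hf
  exact ⟨eulerFactor f, hdiff.differentiableOn, h0, fun y hy hy' =>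
    hSp k f hf (hE k f hf) (hS k f hf) hI (hT k f hf) (hK k f hf) y hy hy'⟩

/-- **The line concludes the crux BY NAME** (the `#h21_check_skeleton` theorem): the six registered stubs, fed to
`systemLSDRealSegment_of_parts`, give `Summit.Parity.BatemanHorn.Theses.AlmostPrimeZeros.SystemLSDRealSegment`.
No `sorry` of its own; its axiom closure contains `sorryAx` exactly through the six `stub_*`. -/
theorem SystemLSDRealSegment_of : SystemLSDRealSegment :=
  systemLSDRealSegment_of_parts stub_eulerFactor stub_smallPrimes stub_integerEwens stub_tiltedTails stub_kpd
    stub_splice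

end

end Summit.Parity.BatemanHorn.Cruxes.SystemLSDRealSegment.EwensPdKernel
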